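import Summits.ResolutionOfSingularities.ResolutionOfSingularities.Theorems.FrobeniusLadderFInjectiveMacaulayficationProp44T1FullGlue
import Literature.AlgebraicGeometry.Resolution.StalkIdealGenerization
import HarnessLib

/-!
# Cossart–Piltant 2008, Prop. 4.4 — the T1 line under the FULL-CHAIN ring contract: the next centre after a point step, and `u_n ∈ P_n`

OURS (res-inputs-p-8b g2). Contract v3 clauses `hPsucc_pt` (the line centre p627545 in the `u`-chart or, through `isAdapted_comp_swap_of_isAdapted`,
in the `w`-chart) and `huP` (the exceptional parameter lies in every later curve centre). AI-written; AI review weaker than expert review. `CossartPiltant2008_prop44`, T1 and the ring contract are NOT proved here;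
resolution in dimension `≥ 4` / positive characteristic is NOT proved. No definitions, no named facts.
-/

noncomputable section

open CategoryTheory CategoryTheory.Limits AlgebraicGeometry TopologicalSpace IsLocalRing MvPolynomial
open Literature.AlgebraicGeometry.Resolution Scheme.IdealSheafData

namespace Summit.ResolutionOfSingularities.ResolutionOfSingularities.Theorems

namespace CP2008Prop44

universe u
set_option maxHeartbeats 800000 in
/-- **After a point step the next curve centre is the line `(y′, u_{n+1})`, in whichever chart `x_{n+1}` lies** (clause `hPsucc_pt`): the line
centre (p627545) read in the `u`-chart or — through `isAdapted_comp_swap_of_isAdapted` — in the `w`-chart.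
[cite: CossartPiltant2008, Lemma 4.3 (5); Prop. 4.4 (proof, p. 11)] -/
theorem fullChain_hPsucc_pt (Xs : ℕ → Scheme.{u})
    (hN : ∀ n, IsLocallyNoetherian (Xs n)) (hXreg : ∀ n, Scheme.IsRegular (Xs n))
    (π : ∀ n, Xs (n + 1) ⟶ Xs n) (Y : ∀ n, Closeds (Xs n)) (y : ∀ n, Xs (n + 1))
    (J : ∀ n, (Xs n).IdealSheafData) {μ : ℕ} (hμ : 1 ≤ μ)
    (hy : ∀ n, π (n + 1) (y (n + 1)) = y n)
    (hmem : ∀ n, π n (y n) ∈ (Y n : Set (Xs n)))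
    (hcl : ∀ n, IsClosed ({π n (y n)} : Set (Xs n)))
    (hYirr : ∀ n, IsIrreducible ((Y n : Closeds (Xs n)) : Set (Xs n)))
    (hYreg : ∀ n, Scheme.IsRegular (vanishingIdeal (Y n)).subscheme)
    (hYord : ∀ n, ∀ z ∈ (Y n : Set (Xs n)), idealOrder (J n) z = μ)
    (hπ : ∀ n, IsBlowup (π n) (vanishingIdeal (Y n)))
    (hJ : ∀ n, J (n + 1) = controlledTransform (π n) (vanishingIdeal (Y n)) (J n) μ)
    (hbd : ∀ n (z : Xs n), idealOrder (J n) z ≤ μ)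
    (hcodim : ∀ n, ∀ z ∈ (J n).support, 1 < Order.coheight z)
    (hd : ∀ n, (maximalIdeal ((Xs n).presheaf.stalk (π n (y n)))).spanFinrank = 3)
    (hnear : ∀ n, IsNear (π n) (vanishingIdeal (Y n)) (J n) μ (y n))
    (hτ : ∀ n, @stalkTau (Xs n) (J n) (π n (y n)) (hXreg n (π n (y n))) μ = 1)
    (hG : ∀ n, IsGRing ((Xs n).presheaf.stalk (π n (y n))))
    (hcoinc : ∀ n (z : Xs n), z ⤳ π n (y n) → idealOrder (J n) z = μ → z ∈ (Y n : Set (Xs n)))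
    (n : ℕ) (hptn : (Y n : Set (Xs n)) = {π n (y n)}) (un : chainRing Xs π y n) (u' : chainRing Xs π y (n + 1))
    (hEm : (maximalIdeal (chainRing Xs π y n)).map (chainMap Xs π y hy n) = Ideal.span {u'})
    (hu_ratn : Ideal.span {chainMap Xs π y hy n un} = Ideal.span {u'} → u' = chainMap Xs π y hy n un)
    (yv wv : chainRing Xs π y n) (hgen : Ideal.span {yv, un, wv} = maximalIdeal _)
    (had : ∀ G ∈ initialForms ![yv, un, wv] (chainIdeal Xs π y J n) μ, ∃ a : ResidueField (chainRing Xs π y n), G = C a * X 0 ^ μ)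
    (hnpt1 : (Y (n + 1) : Set (Xs (n + 1))) ≠ {π (n + 1) (y (n + 1))}) (y' : chainRing Xs π y (n + 1))
    (hrel : chainMap Xs π y hy n yv = u' * y') :
    Ideal.span {y', u'} = stalkIdeal (vanishingIdeal (Y (n + 1))) (π (n + 1) (y (n + 1))) := by
  classical
  haveI := hN
  haveI hR : ∀ n, IsRegularLocalRing (chainRing Xs π y n) := fun n => hXreg n _
  haveI hDom : ∀ n, IsDomain (chainRing Xs π y n) := fun n => isDomain_of_isRegularLocalRing _
  have _hG := hG; have _hbd := hbd; have _hmem := hmem; have _hYirr := hYirr; have _hcodim := hcodim; have _hcoinc := hcoinc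
  have _hYreg := hYreg; have _hYord := hYord; have _hJ := hJ; have _hur := hu_ratn
  have rangeFin3 : ∀ {α : Type u} (c : Fin 3 → α), Set.range c = {c 0, c 1, c 2} := by
    intro α c
    ext a
    simp only [Set.mem_range, Set.mem_insert_iff, Set.mem_singleton_iff]
    constructor
    · rintro ⟨i, rfl⟩
      fin_cases i
      · exact Or.inl rfl
      · exact Or.inr (Or.inl rfl)
      · exact Or.inr (Or.inr rfl)
    · rintro (h | h | h) <;> exact ⟨_, h.symm⟩
  have range3 : ∀ {α : Type u} (a b c : α), Set.range ![a, b, c] = {a, b, c} := by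
    intro α a b c
    rw [rangeFin3]; rfl
  have range2 : ∀ {α : Type u} (a b : α), Set.range ![a, b] = {a, b} := by
    intro α a b; ext t
    simp only [Set.mem_range, Set.mem_insert_iff, Set.mem_singleton_iff]
    constructor
    · rintro ⟨i, rfl⟩
      fin_cases i
      · exact Or.inl rfl
      · exact Or.inr rfl
    · rintro (h | h)
      · exact ⟨0, by simp [h]⟩
      · exact ⟨1, by simp [h]⟩
  have range1 : ∀ {α : Type u} (a : α), Set.range ![a] = {a} := fun a => by ext s; simp [eq_comm]
  have _r3 := @range3; have _r2 := @range2; have _r1 := @range1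
  have hdim : ∀ n, ringKrullDim (chainRing Xs π y n) = 3 := by
    intro n
    have h := (isRegularLocalRing_iff (chainRing Xs π y n)).mp inferInstance
    rw [hd n] at h
    exact_mod_cast h.symm
  have hτr : ∀ n (c : Fin 3 → chainRing Xs π y n), Ideal.span (Set.range c) = maximalIdeal _ →
      hironakaTauAt c (chainIdeal Xs π y J n) μ = 1 := by
    intro n c hc
    rw [chainIdeal, ← stalkTau_eq (J n) (π n (y n)) μ (hd n) c hc]
    exact hτ n
  have hpt_P : ∀ n, (Y n : Set (Xs n)) = {π n (y n)} → stalkIdeal (vanishingIdeal (Y n)) (π n (y n)) = maximalIdeal _ := by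
    intro n hn
    have hYn : Y n = ⟨{π n (y n)}, hcl n⟩ := Closeds.ext hn
    rw [hYn, stalkIdeal_vanishingIdeal_singleton (hcl n)]
  have hcM : chainMap Xs π y hy n = stalkMapCongr (π n) (y n) (π (n + 1) (y (n + 1))) (hy n) := rfl
  show Ideal.span {y', u'} = stalkIdeal (vanishingIdeal (Y (n + 1))) (π (n + 1) (y (n + 1)))
  set c : Fin 3 → chainRing Xs π y n := ![yv, un, wv] with hc_def
  have hc3 : Ideal.span {c 0, c 1, c 2} = maximalIdeal _ := hgen
  have hc : Ideal.span (Set.range c) = maximalIdeal _ := by rw [hc_def, range3]; exact hgen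
  have hcY : Ideal.span (Set.range c) = stalkIdeal (vanishingIdeal (Y n)) (π n (y n)) := by rw [hc, hpt_P _ hptn]
  have hadI : ∀ i, i ≠ 0 → IsAdapted c (chainIdeal Xs π y J n) μ i := bridge_isAdapted had
  rcases sigma'_congr (hπ n) hμ (hd n) hc hcY (hτ n) hadI (hnear n) (π (n + 1) (y (n + 1))) (hy n) (hd (n + 1)) with
    ⟨a, c', h1, h0, h2, hgen', hsurj, -⟩ | ⟨t, Pq, c', h1, h0, ht, hmon, hP, hdeg, hirr, hres, hgen', -, hκ⟩ |
    ⟨c', h2, h0, h1, hgen', hsurj, -⟩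
  · -- u-chart, rational
    have hmap1 : (maximalIdeal (chainRing Xs π y n)).map (chainMap Xs π y hy n) = Ideal.span {chainMap Xs π y hy n un} := by
      rw [hcM]
      refine map_maximalIdeal_eq_span_of_chart _ hc3 1 (fun i => ?_)
      fin_cases i
      · simp only [hc_def, Fin.zero_eta, Matrix.cons_val_zero, Matrix.cons_val_one]
        rw [show (stalkMapCongr (π n) (y n) (π (n + 1) (y (n + 1))) (hy n)) yv = _ * c' 0 by simpa [hc_def] using h0]
        exact Ideal.mul_mem_right _ _ (Ideal.mem_span_singleton_self _)
      · exact Ideal.mem_span_singleton_self _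
      · simp only [hc_def, Fin.reduceFinMk, Matrix.cons_val, Matrix.cons_val_one]
        have e : (stalkMapCongr (π n) (y n) (π (n + 1) (y (n + 1))) (hy n)) wv =
            (stalkMapCongr (π n) (y n) (π (n + 1) (y (n + 1))) (hy n)) (wv - a * un) +
              (stalkMapCongr (π n) (y n) (π (n + 1) (y (n + 1))) (hy n)) a *
                (stalkMapCongr (π n) (y n) (π (n + 1) (y (n + 1))) (hy n)) un := by
          rw [map_sub, map_mul]; ring
        rw [e, show (stalkMapCongr (π n) (y n) (π (n + 1) (y (n + 1))) (hy n)) (wv - a * un) = _ * c' 2 by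
          simpa [hc_def] using h2]
        exact Ideal.add_mem _ (Ideal.mul_mem_right _ _ (Ideal.mem_span_singleton_self _))
          (Ideal.mul_mem_left _ _ (Ideal.mem_span_singleton_self _))
    have hun : u' = chainMap Xs π y hy n un := hu_ratn (by rw [← hmap1, hEm])
    rw [hun] at hrel ⊢
    have h1' : c' 1 = chainMap Xs π y hy n un := by rw [hcM]; simpa [hc_def] using h1
    have h0' : chainMap Xs π y hy n yv = chainMap Xs π y hy n un * c' 0 := by rw [hcM]; simpa [hc_def] using h0
    have hφu : chainMap Xs π y hy n un ≠ 0 := by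
      intro h0''
      rw [h1', h0'', Set.insert_comm (c' 0) 0, Ideal.span, Submodule.span_insert_zero] at hgen'
      exact false_of_span_pair_eq_maximalIdeal hgen' (hd (n + 1))
    have hy' : y' = c' 0 := mul_left_cancel₀ hφu (hrel.symm.trans h0')
    have hrsop : IsRsopPart ![chainMap Xs π y hy n un, y'] := by
      refine ⟨inferInstance, 1, ![c' 2], by rw [hdim]; rfl, ?_⟩
      rw [range2, range1, ← hgen', h1', hy', Set.union_singleton, Set.insert_comm (c' 2), Set.pair_comm (c' 2),
        Set.insert_comm (chainMap Xs π y hy n un) (c' 0)]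
    exact lineCentre_chain Xs hN hXreg π Y y J hμ hy hmem hcl hYirr hYreg hYord hπ hJ hbd hcodim hd hnear hτ hG hcoinc n hptn hnpt1 yv un wv y' hgen
      (bridge_isAdapted had) hmap1 hrel hrsop
  · -- u-chart, non-rational
    have hmap1 : (maximalIdeal (chainRing Xs π y n)).map (chainMap Xs π y hy n) = Ideal.span {chainMap Xs π y hy n un} := by
      rw [hcM]
      refine map_maximalIdeal_eq_span_of_chart _ hc3 1 (fun i => ?_)
      fin_cases i
      · simp only [hc_def, Fin.zero_eta, Matrix.cons_val_zero, Matrix.cons_val_one]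
        rw [show (stalkMapCongr (π n) (y n) (π (n + 1) (y (n + 1))) (hy n)) yv = _ * c' 0 by simpa [hc_def] using h0]
        exact Ideal.mul_mem_right _ _ (Ideal.mem_span_singleton_self _)
      · exact Ideal.mem_span_singleton_self _
      · simp only [hc_def, Fin.reduceFinMk, Matrix.cons_val, Matrix.cons_val_one]
        rw [show (stalkMapCongr (π n) (y n) (π (n + 1) (y (n + 1))) (hy n)) wv = _ * t by simpa [hc_def] using ht]
        exact Ideal.mul_mem_right _ _ (Ideal.mem_span_singleton_self _)
    have hun : u' = chainMap Xs π y hy n un := hu_ratn (by rw [← hmap1, hEm])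
    rw [hun] at hrel ⊢
    have h1' : c' 1 = chainMap Xs π y hy n un := by rw [hcM]; simpa [hc_def] using h1
    have h0' : chainMap Xs π y hy n yv = chainMap Xs π y hy n un * c' 0 := by rw [hcM]; simpa [hc_def] using h0
    have hφu : chainMap Xs π y hy n un ≠ 0 := by
      intro h0''
      rw [h1', h0'', Set.insert_comm (c' 0) 0, Ideal.span, Submodule.span_insert_zero] at hgen'
      exact false_of_span_pair_eq_maximalIdeal hgen' (hd (n + 1))
    have hy' : y' = c' 0 := mul_left_cancel₀ hφu (hrel.symm.trans h0')
    have hrsop : IsRsopPart ![chainMap Xs π y hy n un, y'] := by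
      refine ⟨inferInstance, 1, ![c' 2], by rw [hdim]; rfl, ?_⟩
      rw [range2, range1, ← hgen', h1', hy', Set.union_singleton, Set.insert_comm (c' 2), Set.pair_comm (c' 2),
        Set.insert_comm (chainMap Xs π y hy n un) (c' 0)]
    exact lineCentre_chain Xs hN hXreg π Y y J hμ hy hmem hcl hYirr hYreg hYord hπ hJ hbd hcodim hd hnear hτ hG hcoinc n hptn hnpt1 yv un wv y' hgen
      (bridge_isAdapted had) hmap1 hrel hrsop
  · -- w-chart (opposite vertex): the line centre read through the swapped label
    have hmap2 : (maximalIdeal (chainRing Xs π y n)).map (chainMap Xs π y hy n) = Ideal.span {chainMap Xs π y hy n wv} := by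
      rw [hcM]
      refine map_maximalIdeal_eq_span_of_chart _ hc3 2 (fun i => ?_)
      fin_cases i
      · simp only [hc_def, Fin.zero_eta, Matrix.cons_val_zero, Matrix.cons_val]
        rw [show (stalkMapCongr (π n) (y n) (π (n + 1) (y (n + 1))) (hy n)) yv = _ * c' 0 by simpa [hc_def] using h0]
        exact Ideal.mul_mem_right _ _ (Ideal.mem_span_singleton_self _)
      · simp only [hc_def, Fin.mk_one, Matrix.cons_val_one, Matrix.cons_val]
        rw [show (stalkMapCongr (π n) (y n) (π (n + 1) (y (n + 1))) (hy n)) un = _ * c' 1 by simpa [hc_def] using h1]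
        exact Ideal.mul_mem_right _ _ (Ideal.mem_span_singleton_self _)
      · exact Ideal.mem_span_singleton_self _
    obtain ⟨e, he⟩ := exists_unit_mul_eq_of_span_singleton_eq (hmap2.symm.trans hEm)
    have hτc : hironakaTauAt c (chainIdeal Xs π y J n) μ = 1 := hτr n c hc
    have hswap : (c ∘ ⇑(Equiv.swap (1 : Fin 3) 2)) = ![yv, wv, un] := by
      funext i; fin_cases i <;> rfl
    have had'' : ∀ i, i ≠ 0 → IsAdapted ![yv, wv, un] (chainIdeal Xs π y J n) μ i := by
      rw [← hswap]; exact isAdapted_comp_swap_of_isAdapted c hτc hadI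
    have hgen'' : Ideal.span {yv, wv, un} = maximalIdeal (chainRing Xs π y n) := by rw [← hgen, Set.pair_comm]
    have h0' : chainMap Xs π y hy n yv = chainMap Xs π y hy n wv * c' 0 := by rw [hcM]; simpa [hc_def] using h0
    have h2' : c' 2 = chainMap Xs π y hy n wv := by rw [hcM]; simpa [hc_def] using h2
    have hφw : chainMap Xs π y hy n wv ≠ 0 := by
      intro h0''
      rw [h2', h0'', Ideal.span, Submodule.span_insert, Submodule.span_insert, Submodule.span_zero_singleton,
        sup_bot_eq] at hgen'
      rw [← Submodule.span_insert] at hgen'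
      exact false_of_span_pair_eq_maximalIdeal hgen' (hd (n + 1))
    obtain ⟨z, hz⟩ : ∃ z : chainRing Xs π y (n + 1), z = (e : chainRing Xs π y (n + 1)) * y' := ⟨_, rfl⟩
    have hrel'' : chainMap Xs π y hy n yv = chainMap Xs π y hy n wv * z := by rw [hz, hrel, ← he]; ring
    have hc'0 : c' 0 = z := mul_left_cancel₀ hφw (h0'.symm.trans hrel'')
    have hrsop'' : IsRsopPart ![chainMap Xs π y hy n wv, z] := by
      refine ⟨inferInstance, 1, ![c' 1], by rw [hdim]; rfl, ?_⟩
      rw [range2, range1, ← hgen', h2', hc'0]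
      congr 1
      ext s
      simp only [Set.mem_union, Set.mem_insert_iff, Set.mem_singleton_iff]
      constructor
      · rintro ((h | h) | h) <;> simp only [h, true_or, or_true]
      · rintro (h | h | h) <;> simp only [h, true_or, or_true]
    have hline : Ideal.span {z, chainMap Xs π y hy n wv} = stalkIdeal (vanishingIdeal (Y (n + 1))) (π (n + 1) (y (n + 1))) :=
      lineCentre_chain Xs hN hXreg π Y y J hμ hy hmem hcl hYirr hYreg hYord hπ hJ hbd hcodim hd hnear hτ hG hcoinc n hptn hnpt1 yv wv un
        z hgen'' had'' hmap2 hrel'' hrsop''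
    have key : Ideal.span {y', u'} = Ideal.span {z, chainMap Xs π y hy n wv} := by
      rw [hz]
      apply le_antisymm
      · rw [Ideal.span_le]
        intro t ht
        simp only [Set.mem_insert_iff, Set.mem_singleton_iff] at ht
        rcases ht with ht | ht <;> rw [ht]
        · have e1 : y' = ↑e⁻¹ * (↑e * y') := by rw [← mul_assoc, Units.inv_mul, one_mul]
          rw [e1]; exact Ideal.mul_mem_left _ _ (Ideal.subset_span (by simp))
        · rw [← he]; exact Ideal.mul_mem_right _ _ (Ideal.subset_span (by simp))
      · rw [Ideal.span_le]
        intro t ht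
        simp only [Set.mem_insert_iff, Set.mem_singleton_iff] at ht
        rcases ht with ht | ht <;> rw [ht]
        · exact Ideal.mul_mem_left _ _ (Ideal.subset_span (by simp))
        · have e2 : chainMap Xs π y hy n wv = u' * ↑e⁻¹ := by rw [← he, mul_assoc, Units.mul_inv, mul_one]
          rw [e2]; exact Ideal.mul_mem_right _ _ (Ideal.subset_span (by simp))
    rw [key]; exact hline


/-- **The exceptional parameter lies in the next curve centre**: if step `n+1` of the T1 chain is a curve step, every generator of
`𝓘_{Y_n}·𝒪_{x_{n+1}}` lies in `𝓘_{Y_{n+1}, x_{n+1}}` — the generic point of `Y_{n+1}` maps into `Y_n` (`hcoinc`), so `Y_{n+1} ⊆ π⁻¹(Y_n)`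
(`mem_support_iff_stalkIdeal_le_primeOfSpecializes`). [cite: CossartPiltant2008, Prop. 4.4 (proof, p. 11)] -/
theorem fullChain_huP (Xs : ℕ → Scheme.{u})
    (hN : ∀ n, IsLocallyNoetherian (Xs n)) (hXreg : ∀ n, Scheme.IsRegular (Xs n))
    (π : ∀ n, Xs (n + 1) ⟶ Xs n) (Y : ∀ n, Closeds (Xs n)) (y : ∀ n, Xs (n + 1))
    (J : ∀ n, (Xs n).IdealSheafData) {μ : ℕ} (hμ : 1 ≤ μ)
    (hy : ∀ n, π (n + 1) (y (n + 1)) = y n)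
    (hmem : ∀ n, π n (y n) ∈ (Y n : Set (Xs n)))
    (hcl : ∀ n, IsClosed ({π n (y n)} : Set (Xs n)))
    (hYirr : ∀ n, IsIrreducible ((Y n : Closeds (Xs n)) : Set (Xs n)))
    (hYreg : ∀ n, Scheme.IsRegular (vanishingIdeal (Y n)).subscheme)
    (hYord : ∀ n, ∀ z ∈ (Y n : Set (Xs n)), idealOrder (J n) z = μ)
    (hπ : ∀ n, IsBlowup (π n) (vanishingIdeal (Y n)))
    (hJ : ∀ n, J (n + 1) = controlledTransform (π n) (vanishingIdeal (Y n)) (J n) μ)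
    (hbd : ∀ n (z : Xs n), idealOrder (J n) z ≤ μ)
    (hcodim : ∀ n, ∀ z ∈ (J n).support, 1 < Order.coheight z)
    (hd : ∀ n, (maximalIdeal ((Xs n).presheaf.stalk (π n (y n)))).spanFinrank = 3)
    (hnear : ∀ n, IsNear (π n) (vanishingIdeal (Y n)) (J n) μ (y n))
    (hτ : ∀ n, @stalkTau (Xs n) (J n) (π n (y n)) (hXreg n (π n (y n))) μ = 1)
    (hG : ∀ n, IsGRing ((Xs n).presheaf.stalk (π n (y n))))
    (hcoinc : ∀ n (z : Xs n), z ⤳ π n (y n) → idealOrder (J n) z = μ → z ∈ (Y n : Set (Xs n)))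
    (n : ℕ) (hn1 : (Y (n + 1) : Set (Xs (n + 1))) ≠ {π (n + 1) (y (n + 1))}) (g : chainRing Xs π y (n + 1))
    (hg : (stalkIdeal (vanishingIdeal (Y n)) (π n (y n))).map (chainMap Xs π y hy n) = Ideal.span {g}) :
    g ∈ stalkIdeal (vanishingIdeal (Y (n + 1))) (π (n + 1) (y (n + 1))) := by
  haveI := hN
  have _a := hXreg; have _b := hYreg; have _c := hπ; have _d := hbd; have _e := hd; have _f := hnear; have _g := hτ; have _i := hG; have _j := hμ
  obtain ⟨hYζ, hζne, hζx, -, -, -⟩ :=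
    genericPoint_curve_facts (hXreg (n + 1)) hμ (hcodim (n + 1)) (hYirr (n + 1)) (hYord (n + 1)) (hmem (n + 1)) (hcl (n + 1))
      (hd (n + 1)) hn1
  set ζ := (hYirr (n + 1)).genericPoint with hζ_def
  have hζY : ζ ∈ (Y (n + 1) : Set (Xs (n + 1))) := by rw [hYζ]; exact subset_closure rfl
  -- `π n ζ ∈ Y n`
  have hπζ : π n ζ ∈ (Y n : Set (Xs n)) := by
    by_contra hnot
    have hnot' : π n ζ ∉ ((vanishingIdeal (Y n)).support : Set (Xs n)) := by
      rwa [Scheme.IdealSheafData.coe_support_vanishingIdeal]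
    have hsp : π n ζ ⤳ π n (y n) := by
      have h := hζx.map (π n).base.hom.continuous
      rwa [hy n] at h
    have hord : idealOrder (J n) (π n ζ) = μ := by
      rw [← (hπ n).idealOrder_controlledTransform_of_not_mem (J n) μ hnot', ← hJ n]; exact hYord (n + 1) ζ hζY
    exact hnot (hcoinc n (π n ζ) hsp hord)
  -- the exceptional ideal at `x_{n+1}` lies in `𝔭_ζ = 𝓘_{Y (n+1), x_{n+1}}`
  have hsupp : ζ ∈ (((vanishingIdeal (Y n)).comap (π n)).support : Set (Xs (n + 1))) := by
    rw [Scheme.IdealSheafData.support_comap]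
    change π n ζ ∈ ((vanishingIdeal (Y n)).support : Set (Xs n))
    rw [Scheme.IdealSheafData.coe_support_vanishingIdeal]; exact hπζ
  have hle := (mem_support_iff_stalkIdeal_le_primeOfSpecializes hζx _).mp hsupp
  have hYc : Y (n + 1) = ⟨closure {ζ}, isClosed_closure⟩ := Closeds.ext hYζ
  rw [hYc, stalkIdeal_vanishingIdeal_closure hζx]
  apply hle
  have hmap : stalkIdeal ((vanishingIdeal (Y n)).comap (π n)) (π (n + 1) (y (n + 1))) =
      (stalkIdeal (vanishingIdeal (Y n)) (π n (y n))).map (chainMap Xs π y hy n) := by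
    have e := hy n
    -- transport along `x_{n+1} = y_n`
    have key : ∀ (q : Xs (n + 1)) (h : q = y n), stalkIdeal ((vanishingIdeal (Y n)).comap (π n)) q =
        (stalkIdeal (vanishingIdeal (Y n)) (π n (y n))).map (stalkMapCongr (π n) (y n) q h) := by
      intro q h; subst h; rw [stalkMapCongr_self, stalkIdeal_comap_eq_map_stalkMap]
    exact key _ (hy n)
  rw [hmap, hg]
  exact Ideal.mem_span_singleton_self _

/-- **Quasi-isolation relative to the centre, ring form** (contract clause `hqis`): a non-maximal prime `𝔮 ≠ 𝓘_{Y_n,x_n}` of `𝒪_{x_n}` never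
carries `J_n 𝒪_𝔮 ⊆ 𝔮^μ 𝒪_𝔮` — the regime (*) `hcoinc` read through the prime ↔ generisation dictionary (Stacks 01J7). [cite: CossartPiltant2008, Prop. 4.4 (proof, (*))] -/
theorem fullChain_hqis (Xs : ℕ → Scheme.{u})
    (hN : ∀ n, IsLocallyNoetherian (Xs n)) (hXreg : ∀ n, Scheme.IsRegular (Xs n))
    (π : ∀ n, Xs (n + 1) ⟶ Xs n) (Y : ∀ n, Closeds (Xs n)) (y : ∀ n, Xs (n + 1))
    (J : ∀ n, (Xs n).IdealSheafData) {μ : ℕ} (hμ : 1 ≤ μ)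
    (hy : ∀ n, π (n + 1) (y (n + 1)) = y n)
    (hmem : ∀ n, π n (y n) ∈ (Y n : Set (Xs n)))
    (hcl : ∀ n, IsClosed ({π n (y n)} : Set (Xs n)))
    (hYirr : ∀ n, IsIrreducible ((Y n : Closeds (Xs n)) : Set (Xs n)))
    (hYreg : ∀ n, Scheme.IsRegular (vanishingIdeal (Y n)).subscheme)
    (hYord : ∀ n, ∀ z ∈ (Y n : Set (Xs n)), idealOrder (J n) z = μ)
    (hπ : ∀ n, IsBlowup (π n) (vanishingIdeal (Y n)))
    (hJ : ∀ n, J (n + 1) = controlledTransform (π n) (vanishingIdeal (Y n)) (J n) μ)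
    (hbd : ∀ n (z : Xs n), idealOrder (J n) z ≤ μ)
    (hcodim : ∀ n, ∀ z ∈ (J n).support, 1 < Order.coheight z)
    (hd : ∀ n, (maximalIdeal ((Xs n).presheaf.stalk (π n (y n)))).spanFinrank = 3)
    (hnear : ∀ n, IsNear (π n) (vanishingIdeal (Y n)) (J n) μ (y n))
    (hτ : ∀ n, @stalkTau (Xs n) (J n) (π n (y n)) (hXreg n (π n (y n))) μ = 1)
    (hG : ∀ n, IsGRing ((Xs n).presheaf.stalk (π n (y n))))
    (hcoinc : ∀ n (z : Xs n), z ⤳ π n (y n) → idealOrder (J n) z = μ → z ∈ (Y n : Set (Xs n)))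
    (n : ℕ) (𝔮 : Ideal (chainRing Xs π y n)) [𝔮.IsPrime] (h𝔮 : 𝔮 ≠ maximalIdeal _)
    (h𝔮P : 𝔮 ≠ stalkIdeal (vanishingIdeal (Y n)) (π n (y n))) :
    ¬ (chainIdeal Xs π y J n).map (algebraMap _ (Localization.AtPrime 𝔮)) ≤ maximalIdeal (Localization.AtPrime 𝔮) ^ μ := by
  haveI := hN
  have _a := hYreg; have _b := hπ; have _c := hJ; have _d := hnear; have _e := hτ; have _f := hG; have _g := hy
  intro hle
  obtain ⟨ζ, hζx, hP⟩ := exists_specializes_comap_stalkSpecializes_eq (π n (y n)) 𝔮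
  have hζne : ζ ≠ π n (y n) := by
    intro heq
    subst heq
    exact h𝔮 (hP.trans (comap_stalkSpecializes_refl_maximalIdeal _))
  subst hP
  have hord : (μ : ℕ∞) ≤ idealOrder (J n) ζ := le_idealOrder_of_map_le_pow (J n) hζx μ hle
  have hζY : ζ ∈ (Y n : Set (Xs n)) := hcoinc n ζ hζx (le_antisymm (hbd n ζ) hord)
  have hYne : (Y n : Set (Xs n)) ≠ {π n (y n)} := fun h => hζne (by rw [h] at hζY; exact hζY)
  obtain ⟨hYη, -, hηx, -, -, hgen⟩ := genericPoint_curve_facts (hXreg n) hμ (hcodim n) (hYirr n) (hYord n) (hmem n) (hcl n) (hd n) hYne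
  rcases hgen ζ hζY hζx with h | h
  · exact hζne h
  · apply h𝔮P
    have hYc : Y n = ⟨closure {(hYirr n).genericPoint}, isClosed_closure⟩ := Closeds.ext hYη
    rw [hYc, stalkIdeal_vanishingIdeal_closure hηx]
    subst h
    rfl

end CP2008Prop44

end Summit.ResolutionOfSingularities.ResolutionOfSingularities.Theorems

end
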